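import Literature.MathematicalPhysics.QuantumFieldTheory.Balaban1983to89.B9Thm311SitePrimeFormCoercivePlaquette
import Literature.MathematicalPhysics.QuantumFieldTheory.Balaban1983to89.B9Thm311SitePrimeFormCoerciveTowerCanonical

/-!
# `Balaban1983to89.B9Eq342GreenPrimeEnergyLetter` — T. Bałaban, *Propagators for lattice gauge theories in a background field*, Commun. Math. Phys.
# **99** (1985) 389–434 [Balaban1985BackgroundPropagators] (3.24)–(3.25) p. 394, Thm 3.1 (3.42) p. 397, Thm 3.11 p. 416: **THE ENERGY LETTER (E)
# `‖G′(U)g‖ ≤ C_E‖g‖` ∕ `‖G′_k(U)g‖ ≤ C_E‖g‖` OF THE VALUE ROW OF (3.42), INHABITED ON PRINT's CLASS WITH A LEVEL-FREE `C_E`** — the binder `hE` of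
# `B9Eq342GreenPrimeSupBound.norm_GpOfU_apply_le(_unitary)` (one step) and of `B9Eq342GreenPrimeTowerSupBound.norm_GpOfUk_apply_le(_unitary)` (`k = n+1`
# levels), read off the tree's coercivity theorems BY NAME: `‖T⁻¹y‖ ≤ γ⁻¹‖y‖` for a `γ`-coercive `T` (`B9Eq3126GreenLetters.norm_greenK_le`) at
# `T = Δ′_{a′}(U)` (plaquette class: `B9Thm311SitePrimeFormCoercivePlaquette.site_coercive_of_small_plaquettes_canonical`, `γ = (1 − κ₀)∕(3 + 4∕a′)` on the
# diagonal `ηL = 1`) and at `T = Δ′_{a′,k}(U)` (geometric-profile small-field class on the diagonal `ηL^{n+1} = 1`: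
# `B9Thm311SitePrimeFormCoerciveTowerCanonical.coercive_laplacePrimeAk_diagonal_geometric`, `γ = 1∕(2+2∕a′) − θ⋆(α)`; `∃`-form `C_E = 2(2 + 2∕a′)` for EVERY height)

statement-level skeleton of published theorems with citation tags; proofs where landed; nothing here is a claim about the Yang–Mills mass gap

CITATION HEADER (lean-in-tree rule).  Audit cell `pub-balaban`, sub-cell `t4`, BINDER row NE9; filed by NE9 formalisation-swarm LEAF PROVER 03 (lineage
`b2b-balaban-t4-ne9-formalise-leaf-03`, gen 70) for the row OWNER `t4-ne9-p1`'s SUP-NORM PROGRAMME (plan v10, `g89/SUP-NORM-PROGRAMME.md` §6 OPEN (1): *«for the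
ONE-STEP `G′(U)` the VALUE row of (3.42) has every letter inhabited except … the one-step energy bound (read `norm_Gk_le` at `n = 0` or a direct coercivity
line)»*; INTENT-9 l.54660: *«`C_E` (the one-step energy bound — the chain's `norm_Gk_le` is typed at the tower; one-step twin = its `n = 0` reading or a direct
coercivity line)»*).  Sources READ first-hand by this lineage in the held text layer `paper:balaban1985-cmp99-background-propagators` (journal page = PDF page
+ 388): p. 394 (3.24) *«Δ′_a = Δ_U + Q′*(U) a Q′(U)»*, (3.25) *«G′ = G′(U) = (Δ′_a)⁻¹»*; p. 397 Thm 3.1 *«There exist positive constants M₁, δ₀, a₀, B₀ dependent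
on d and L only … |(G′(U)λ)(x)|, … ≤ B₀ … (3.42)»*; p. 416 Thm 3.11 *«the operators Δ′_a, G′, (Q′G′²Q′*)⁻¹, Δ_a, G are positive definite»* and p. 400 Thm 3.4
*«G = Δ_a⁻¹ is bounded»* (the operator-norm reading).  NOTHING of print's random-walk proof (pp. 415–426) is reproduced; the `[cite: …]` tags locate the printed
symbols; every statement is a `[folklore]` composition of landed theorems.

WHY THIS FILE (cell context).  The OWNER's VALUE row `B9Eq342GreenPrime(Tower)SupBound.norm_GpOfU(k)_apply_le` displays four letters (T)(P)(E)(FS) + (supp);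
(T) is discharged there, (P) by this lineage's `B9Eq324PenaltyPointwiseBound(Unitary)`, (FS) by ne9-leaf-02's `B5Eq129FreeResolventZoneSum(Letters∕Sites)`.
(E) — `‖G′g‖ ≤ C_E‖g‖` — was the one letter with no NAMED inhabitant: the tree holds the coercivity of `Δ′_{a′}(U)` ∕ `Δ′_{a′,k}(U)` on print's classes and
the abstract `norm_greenK_le`, used inline in three places (`B9Eq325RLipschitzClosedSqrt`, `B9Eq325RLipschitzSqrtTowerTwoBackgroundsDiagonal`).  This file names
the composition in the exact `hE` shape, so that the CLOSED value row (sequel) cites one theorem per letter.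

WHAT IS PROVED (sorry-free; 0 `def`; [folklore] two-line compositions BY NAME).
* §1 ONE STEP, ANY COERCIVITY: **`norm_GpOfU_le_of_coercive`** — `γ‖x‖² ≤ re⟨x, Δ′_{a′}(U)x⟩ (γ > 0) ⇒ ‖G′(U)g‖ ≤ γ⁻¹‖g‖` for every positivity witness
  `hpos′` (the value `GpOfU … hpos′ = greenK …` does not depend on which witness is displayed).
* §2 ONE STEP ON THE PLAQUETTE CLASS (3.35) (unit-bounded unitary `U`, `‖U(∂p) − 1‖ ≤ δ ≤ α₀η²`, `2 ≤ m_i`, along `c₁(ηL)² = c₀L^d`, `0 < ηL ≤ 1`, tracial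
  norming `‖φ‖ ≤ M_φ`, `‖φ⁻¹‖ ≤ M_φ′`; `κ₀ = 8d³A² + 4(2d²A·e^{2d²A})²`, `A = M_φM_φ′α₀`, `κ₀ < 1`): **`norm_GpOfU_le_of_small_plaquettes`** —
  `‖G′(U)g‖ ≤ ((3 + 4∕a′)∕(1 − κ₀))·(ηL)²·‖g‖`; **`norm_GpOfU_le_of_small_plaquettes_diagonal`** (`ηL = 1`): `C_E = (3 + 4∕a′)∕(1 − κ₀)` — free of `η, m, L,
  c₀, c₁`, the volume and the background inside the class; **`exists_normBound_GpOfU_of_small_plaquettes`** — the `∃ A₁ C_E > 0` BEFORE `∀ L m U δ η c₀ c₁ α₀`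
  shape (`C_E = 2(3 + 4∕a′)` from `exists_site_strong_coercive_of_small_plaquettes`).
* §3 `k = n+1` LEVELS, ANY COERCIVITY: **`norm_GpOfUk_le_of_coercive`**.
* §4 `k = n+1` LEVELS ON THE DIAGONAL `ηL^{n+1} = 1`, `c₀(L^{n+1})^d = c₁`, GEOMETRIC PROFILE `‖Ū^j(b) − 1‖ ≤ ε_j ≤ αr^j` (mutually adjoint transporters,
  `U1`, `‖U(b) − 1‖ ≤ αη`): **`norm_GpOfUk_le_diagonal_geometric`** — `‖G′_k(U)g‖ ≤ (1∕(2+2∕a′) − θ⋆(α))⁻¹·‖g‖` on `θ⋆(α) < 1∕(2+2∕a′)`, `θ⋆` the closed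
  function of `(d, a′, 2M_φM_φ′, L, r, α)` of `coercive_laplacePrimeAk_diagonal_geometric` — THE SAME FOR EVERY HEIGHT `n`; **`exists_normBound_GpOfUk_tower_diagonal`**
  — `∃ α₀ C_E > 0` BEFORE `∀ n η c₀ c₁ m U α ε`: `‖G′_k(U)g‖ ≤ C_E‖g‖` (`C_E = (γ′)⁻¹ = 2(2 + 2∕a′)` of `exists_strong_site_coercive_tower_diagonal`).
MODEL ∕ DECLARED READINGS.  (M1) the chain's encodings verbatim (`laplacePrimeA`∕`GpOfU`, `laplacePrimeAk`∕`GpOfUk`); (M2) the classes are EXACTLY the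
hypothesis lists of the two coercivity files (nothing added, nothing hidden); (M3) `C_E` explicit; NOT HERE: (3.42)'s decay, the ∇-row, Hölder norms, the
bond operator.
HONEST SCOPE.  [folklore] plumbing; ONE displayed letter of the OWNER's substitute route inhabited — NOT Thm 3.1, nothing of its proof; «NE9 ⇐ the named
binders»; NE9 NOT PRINTED ∕ NOT PROVED; row WALLED ON A MODEL (O-NE9-1; #5 UNRULED); NOT summit progress (cell pub-balaban: spine PROVED 0∕9; rung (B)+1 finite
T⁴ — NOT infinite volume, NOT mass gap, NOT BetaPertH, NOT Clay).  HONEST DEPENDENCY (cell line): continuum YM on T⁴ ⇐ BetaPertH ∧ nine spine estimates (0/9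
proved); BetaPertH ⇐ (D1) ∧ (D4) ∧ CAP+tail; G-an2-4 gates asym, D1 and NE2/3/4.  NEW file importing `B9Thm311SitePrimeFormCoercivePlaquette` +
`B9Thm311SitePrimeFormCoerciveTowerCanonical`; nothing modified.  Net new unproved facts: 0.
-/

noncomputable section

open scoped InnerProductSpace ComplexConjugate BigOperators

namespace Literature.MathematicalPhysics.QuantumFieldTheory.Balaban1983to89.B9Eq342GreenPrimeEnergyLetter

open B4Sect5Torus (TSite)
open B9SectCLatticeCarrier (Bond)
open B7Prop1Explicit (U1)
open B9Eq319QprimeTorus (fineP)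
open B9Eq315QTower (towerP UlevOf)
open B11Eq103H1Complex (SiteL2K covDerivL2K)
open B9Eq310HessianOperator (adTransportW)
open B9Eq310DeltaPrime (plaqHolU)
open B9Eq3119DeltaPiCarrier (laplacePrimeA GpOfU)
open B9Eq324DeltaPrimeATower (laplacePrimeAk GpOfUk)
open B9Eq3126GreenLetters (norm_greenK_le)
open B9Thm311SitePrimeFormCoercivePlaquette (site_coercive_of_small_plaquettes_canonical exists_site_strong_coercive_of_small_plaquettes)
open B9Thm311SitePrimeFormCoerciveTowerCanonical (coercive_laplacePrimeAk_diagonal_geometric exists_strong_site_coercive_tower_diagonal)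

/-! ## §1 One step, any displayed coercivity -/

section OneStep

variable {d : ℕ} (L : ℕ) [NeZero L] (m : Fin d → ℕ) {𝔸 : Type*} [Ring 𝔸] [Algebra ℂ 𝔸]
  {W : Type*} [NormedAddCommGroup W] [InnerProductSpace ℂ W] [FiniteDimensional ℂ W] (φ : W ≃ₗ[ℂ] 𝔸) {c₀ : ℝ} [Fact (0 < c₀)]
  (η : ℝ) (U : Bond d (fineP L m) → 𝔸ˣ) {c₁ : ℝ} [Fact (0 < c₁)] (a' : ℝ)

/-- **(E) FROM ANY COERCIVITY CONSTANT**: `γ‖x‖² ≤ re⟨x, Δ′_{a′}(U)x⟩` for all `x` (`γ > 0`) gives `‖G′(U)g‖ ≤ γ⁻¹‖g‖` — print's «G′ = (Δ′_a)⁻¹ …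
positive definite» read as an operator bound (`B9Eq3126GreenLetters.norm_greenK_le` at `T = Δ′_{a′}(U)`), for whichever positivity witness `hpos′` the
chain displays. [cite: Balaban1985BackgroundPropagators, (3.25) p.394, Thm 3.11 p.416, Thm 3.4 p.400] -/
theorem norm_GpOfU_le_of_coercive {γ : ℝ} (hγ : 0 < γ)
    (hco : ∀ x : SiteL2K ℂ d (fineP L m) c₀ W, γ * ‖x‖ ^ 2 ≤ RCLike.re ⟪x, laplacePrimeA L m φ η U a' (c₁ := c₁) x⟫_ℂ)
    (hpos' : ∀ x : SiteL2K ℂ d (fineP L m) c₀ W, x ≠ 0 → 0 < RCLike.re ⟪x, laplacePrimeA L m φ η U a' (c₁ := c₁) x⟫_ℂ)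
    (g : SiteL2K ℂ d (fineP L m) c₀ W) : ‖GpOfU L m φ η U a' hpos' g‖ ≤ γ⁻¹ * ‖g‖ := by
  unfold GpOfU; exact norm_greenK_le hγ hco hpos' g

end OneStep

/-! ## §2 One step on the plaquette class (3.35): `C_E = (3 + 4∕a′)∕(1 − κ₀)` on the diagonal -/

section Plaquette

variable {d : ℕ} (L : ℕ) [NeZero L] (m : Fin d → ℕ) [∀ i, NeZero (fineP L m i)]
  {𝔸 : Type*} [NormedRing 𝔸] [NormedAlgebra ℂ 𝔸] [NormOneClass 𝔸] [StarRing 𝔸]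
  {W : Type*} [NormedAddCommGroup W] [InnerProductSpace ℂ W] [FiniteDimensional ℂ W] (φ : W ≃ₗ[ℂ] 𝔸) {c₀ c₁ : ℝ} [Fact (0 < c₀)] [Fact (0 < c₁)]
  (τ : 𝔸 →ₗ[ℂ] ℂ) {Mφ Mφ' : ℝ} (hMφ : 0 ≤ Mφ) (hMφ' : 0 ≤ Mφ') (hφ : ∀ w, ‖φ w‖ ≤ Mφ * ‖w‖) (hφ' : ∀ X, ‖φ.symm X‖ ≤ Mφ' * ‖X‖)
  (hτφ : ∀ X Y : 𝔸, ⟪φ.symm X, φ.symm Y⟫_ℂ = τ (star X * Y)) (htr : ∀ X Y : 𝔸, τ (X * Y) = τ (Y * X))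
  (hm : ∀ i, 2 ≤ m i) {U : Bond d (fineP L m) → 𝔸ˣ} (hU : ∀ b, U b ∈ U1 𝔸) (hUstar : ∀ b, star (U b : 𝔸) = (((U b)⁻¹ : 𝔸ˣ) : 𝔸))
  {δ : ℝ} (hδ0 : 0 ≤ δ) (hδ : ∀ p : B9SectCLatticeCarrier.Plaq d (fineP L m), ‖(plaqHolU U p : 𝔸) - 1‖ ≤ δ)
  {η : ℝ} (hη : η ≠ 0) {a' : ℝ} (ha' : 0 < a') (hηL0 : 0 < η * L) (hs : c₁ * (η * L) ^ 2 = c₀ * (L : ℝ) ^ d)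

include hMφ hMφ' hφ hφ' hτφ htr hm hU hUstar hδ0 hδ hη ha' hηL0 hs in
/-- **(E) ON THE PLAQUETTE CLASS, THE SLAB `0 < ηL ≤ 1`**: with `A = M_φM_φ′α₀`, `κ₀ = 8d³A² + 4(2d²A·e^{2d²A})² < 1`:
`‖G′(U)g‖ ≤ ((3 + 4∕a′)∕(1 − κ₀))·(ηL)²·‖g‖` — `norm_greenK_le` at the weak row of `site_coercive_of_small_plaquettes_canonical`
(`γ = (1 − κ₀)(ηL)⁻²∕(3 + 4∕a′)`); since `(ηL)² ≤ 1` on the slab this is the STRONGER statement — the diagonal constant of the next theorem bounds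
`G′(U)` on the whole slab (ne9-leaf-06 g71's R-1 wording). [cite: Balaban1985BackgroundPropagators, (3.25) p.394, (3.35) p.396, Thm 3.11 p.416, Thm 3.1 (3.42) p.397] -/
theorem norm_GpOfU_le_of_small_plaquettes (hηL1 : η * L ≤ 1) {α₀ : ℝ} (hα₀ : 0 ≤ α₀) (hδα : δ ≤ α₀ * η ^ 2)
    (hκ₀ : 8 * d ^ 3 * (Mφ * Mφ' * α₀) ^ 2 + 4 * (2 * d ^ 2 * (Mφ * Mφ' * α₀) * Real.exp (2 * d ^ 2 * (Mφ * Mφ' * α₀))) ^ 2 < 1)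
    (hpos' : ∀ x : SiteL2K ℂ d (fineP L m) c₀ W, x ≠ 0 → 0 < RCLike.re ⟪x, laplacePrimeA L m φ η U a' (c₁ := c₁) x⟫_ℂ)
    (g : SiteL2K ℂ d (fineP L m) c₀ W) :
    ‖GpOfU L m φ η U a' hpos' g‖ ≤
      (3 + 4 / a') / (1 - (8 * d ^ 3 * (Mφ * Mφ' * α₀) ^ 2 +
          4 * (2 * d ^ 2 * (Mφ * Mφ' * α₀) * Real.exp (2 * d ^ 2 * (Mφ * Mφ' * α₀))) ^ 2)) * (η * L) ^ 2 * ‖g‖ := by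
  set κ₀ : ℝ := 8 * d ^ 3 * (Mφ * Mφ' * α₀) ^ 2 +
    4 * (2 * d ^ 2 * (Mφ * Mφ' * α₀) * Real.exp (2 * d ^ 2 * (Mφ * Mφ' * α₀))) ^ 2 with hκ₀def
  have hk : 0 < 1 - κ₀ := by linarith
  have ha3 : 0 < 3 + 4 / a' := by positivity
  have ht : 0 < η * L := hηL0
  -- the coercivity constant of the weak row
  set γ : ℝ := 1 / (3 + 4 / a') * (1 - κ₀) * ((η * L)⁻¹) ^ 2 with hγdef
  have hγ : 0 < γ := by rw [hγdef]; positivity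
  have hco : ∀ x : SiteL2K ℂ d (fineP L m) c₀ W, γ * ‖x‖ ^ 2 ≤ RCLike.re ⟪x, laplacePrimeA L m φ η U a' (c₁ := c₁) x⟫_ℂ := by
    intro x
    have h := site_coercive_of_small_plaquettes_canonical L m φ (c₁ := c₁) τ hMφ hMφ' hφ hφ' hτφ htr hm hU hUstar hδ0 hδ hη ha' hηL0 hs
      hηL1 hα₀ hδα x
    have e : γ * ‖x‖ ^ 2 = 1 / (3 + 4 / a') * (1 - κ₀) * (((η * L)⁻¹) ^ 2 * ‖x‖ ^ 2) := by rw [hγdef]; ring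
    rw [e]; exact h
  have hG := norm_GpOfU_le_of_coercive L m φ η U a' hγ hco hpos' g
  have h1 : (3 + 4 / a') ≠ 0 := ha3.ne'
  have h2 : 1 - κ₀ ≠ 0 := hk.ne'
  have h3 : η * L ≠ 0 := ht.ne'
  have h4 : a' ≠ 0 := ha'.ne'
  have hγinv : γ⁻¹ = (3 + 4 / a') / (1 - κ₀) * (η * L) ^ 2 := by
    rw [hγdef]
    field_simp
  rw [hγinv] at hG
  exact hG

include hMφ hMφ' hφ hφ' hτφ htr hm hU hUstar hδ0 hδ hη ha' hηL0 hs in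
/-- **(E) ON THE PLAQUETTE CLASS, THE DIAGONAL `ηL = 1`**: `‖G′(U)g‖ ≤ ((3 + 4∕a′)∕(1 − κ₀))·‖g‖` — `C_E` FREE OF `η, m, L, c₀, c₁`, the volume and the
background inside the class: the `hE` binder of `B9Eq342GreenPrimeSupBound.norm_GpOfU_apply_le(_unitary)` INHABITED at print's point `L^jη = 1`.
[cite: Balaban1985BackgroundPropagators, (3.25) p.394, (3.35) p.396, Thm 3.11 p.416, Thm 3.1 (3.42) p.397] -/
theorem norm_GpOfU_le_of_small_plaquettes_diagonal (hηL : η * L = 1) {α₀ : ℝ} (hα₀ : 0 ≤ α₀) (hδα : δ ≤ α₀ * η ^ 2)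
    (hκ₀ : 8 * d ^ 3 * (Mφ * Mφ' * α₀) ^ 2 + 4 * (2 * d ^ 2 * (Mφ * Mφ' * α₀) * Real.exp (2 * d ^ 2 * (Mφ * Mφ' * α₀))) ^ 2 < 1)
    (hpos' : ∀ x : SiteL2K ℂ d (fineP L m) c₀ W, x ≠ 0 → 0 < RCLike.re ⟪x, laplacePrimeA L m φ η U a' (c₁ := c₁) x⟫_ℂ)
    (g : SiteL2K ℂ d (fineP L m) c₀ W) :
    ‖GpOfU L m φ η U a' hpos' g‖ ≤
      (3 + 4 / a') / (1 - (8 * d ^ 3 * (Mφ * Mφ' * α₀) ^ 2 +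
          4 * (2 * d ^ 2 * (Mφ * Mφ' * α₀) * Real.exp (2 * d ^ 2 * (Mφ * Mφ' * α₀))) ^ 2)) * ‖g‖ := by
  have h := norm_GpOfU_le_of_small_plaquettes L m φ (c₁ := c₁) τ hMφ hMφ' hφ hφ' hτφ htr hm hU hUstar hδ0 hδ hη ha' hηL0 hs hηL.le hα₀ hδα
    hκ₀ hpos' g
  rw [hηL, one_pow, mul_one] at h
  exact h

include hMφ hMφ' hφ hφ' hτφ htr ha' in
/-- **(E) IN THE (SC) QUANTIFIER SHAPE — `∃ A₁ C_E > 0` BEFORE `∀ L ∀ m ∀ U ∀ δ ∀ η ∀ c₀ c₁ ∀ α₀`**: with the `A₁(d)`, `γ(a′) = 1∕(2(3 + 4∕a′))` of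
`exists_site_strong_coercive_of_small_plaquettes`, `C_E := γ⁻¹ = 2(3 + 4∕a′)`: on EVERY lattice `T_{L·m}` (`2 ≤ m_i`), for EVERY unit-bounded unitary `U`
with `‖U(∂p) − 1‖ ≤ δ ≤ α₀η²`, `M_φM_φ′α₀ ≤ A₁`, along `c₁(ηL)² = c₀L^d`, `0 < ηL ≤ 1`, and every positivity witness: `‖G′(U)g‖ ≤ C_E‖g‖`
(`(ηL)⁻² ≥ 1` turns the strong row into `γ‖λ‖² ≤ re⟨λ, Δ′λ⟩`). [cite: Balaban1985BackgroundPropagators, (3.25) p.394, (3.35) p.396, Thm 3.11 p.416, Thm 3.1 (3.42) p.397] -/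
theorem exists_normBound_GpOfU_of_small_plaquettes :
    ∃ A₁ CE : ℝ, 0 < A₁ ∧ 0 < CE ∧
      ∀ (L : ℕ) [NeZero L] (m : Fin d → ℕ) [∀ i, NeZero (fineP L m i)], (∀ i, 2 ≤ m i) →
      ∀ (U : Bond d (fineP L m) → 𝔸ˣ), (∀ b, U b ∈ U1 𝔸) → (∀ b, star (U b : 𝔸) = (((U b)⁻¹ : 𝔸ˣ) : 𝔸)) →
      ∀ (δ : ℝ), 0 ≤ δ → (∀ p : B9SectCLatticeCarrier.Plaq d (fineP L m), ‖(plaqHolU U p : 𝔸) - 1‖ ≤ δ) →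
      ∀ (η : ℝ), 0 < η * L → η * L ≤ 1 →
      ∀ (c₀ c₁ : ℝ) [Fact (0 < c₀)] [Fact (0 < c₁)], c₁ * (η * L) ^ 2 = c₀ * (L : ℝ) ^ d →
      ∀ (α₀ : ℝ), 0 ≤ α₀ → δ ≤ α₀ * η ^ 2 → Mφ * Mφ' * α₀ ≤ A₁ →
      ∀ (hpos' : ∀ x : SiteL2K ℂ d (fineP L m) c₀ W, x ≠ 0 → 0 < RCLike.re ⟪x, laplacePrimeA L m φ η U a' (c₁ := c₁) x⟫_ℂ)
        (g : SiteL2K ℂ d (fineP L m) c₀ W), ‖GpOfU L m φ η U a' hpos' g‖ ≤ CE * ‖g‖ := by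
  obtain ⟨A₁, γ, hA₁, hγ, H⟩ := exists_site_strong_coercive_of_small_plaquettes (d := d) φ τ hMφ hMφ' hφ hφ' hτφ htr ha'
  refine ⟨A₁, γ⁻¹, hA₁, by positivity, ?_⟩
  intro L _ m _ hm U hU hUstar δ hδ0 hδ η hηL0 hηL1 c₀ c₁ _ _ hs α₀ hα₀ hδα hA hpos' g
  refine norm_GpOfU_le_of_coercive L m φ η U a' hγ (fun x => ?_) hpos' g
  have h := H L m hm U hU hUstar δ hδ0 hδ η hηL0 hηL1 c₀ c₁ hs α₀ hα₀ hδα hA x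
  -- drop the gradient row and use `(ηL)⁻² ≥ 1`
  have hD : 0 ≤ ‖covDerivL2K ℂ c₀ ((η : ℂ))⁻¹ (adTransportW φ U) x‖ ^ 2 := sq_nonneg _
  have ht : 1 ≤ ((η * L)⁻¹) ^ 2 := by
    have h1 : 1 ≤ (η * L)⁻¹ := one_le_inv_iff₀.2 ⟨hηL0, hηL1⟩
    nlinarith
  have hx : 0 ≤ ‖x‖ ^ 2 := sq_nonneg _
  have : γ * ‖x‖ ^ 2 ≤ γ * (‖covDerivL2K ℂ c₀ ((η : ℂ))⁻¹ (adTransportW φ U) x‖ ^ 2 + ((η * L)⁻¹) ^ 2 * ‖x‖ ^ 2) := by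
    refine mul_le_mul_of_nonneg_left ?_ hγ.le
    nlinarith
  exact this.trans h

end Plaquette

/-! ## §3 `k = n+1` levels, any displayed coercivity -/

section TowerAny

variable {d : ℕ} (L : ℕ) [NeZero L] (m : Fin d → ℕ) [∀ i, NeZero (m i)] (n : ℕ)
  {𝔸 : Type*} [NormedRing 𝔸] [NormedAlgebra ℂ 𝔸] [CompleteSpace 𝔸]
  {W : Type*} [NormedAddCommGroup W] [InnerProductSpace ℂ W] [FiniteDimensional ℂ W] (φ : W ≃ₗ[ℂ] 𝔸) {c₀ : ℝ} [Fact (0 < c₀)]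
  (η : ℝ) (U : Bond d (towerP L m (n + 1)) → 𝔸ˣ) {c₁ : ℝ} [Fact (0 < c₁)] (a' : ℝ)

/-- **(E) AT `k = n+1` LEVELS FROM ANY COERCIVITY CONSTANT**: `γ‖x‖² ≤ re⟨x, Δ′_{a′,k}(U)x⟩ ⇒ ‖G′_k(U)g‖ ≤ γ⁻¹‖g‖`.
[cite: Balaban1985BackgroundPropagators, (3.25) p.394, Thm 3.11 p.416, Thm 3.4 p.400] -/
theorem norm_GpOfUk_le_of_coercive {γ : ℝ} (hγ : 0 < γ)
    (hco : ∀ x : SiteL2K ℂ d (towerP L m (n + 1)) c₀ W, γ * ‖x‖ ^ 2 ≤ RCLike.re ⟪x, laplacePrimeAk L m n φ η U a' (c₁ := c₁) x⟫_ℂ)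
    (hpos' : ∀ x : SiteL2K ℂ d (towerP L m (n + 1)) c₀ W, x ≠ 0 → 0 < RCLike.re ⟪x, laplacePrimeAk L m n φ η U a' (c₁ := c₁) x⟫_ℂ)
    (g : SiteL2K ℂ d (towerP L m (n + 1)) c₀ W) : ‖GpOfUk L m n φ η U a' hpos' g‖ ≤ γ⁻¹ * ‖g‖ := by
  unfold GpOfUk; exact norm_greenK_le hγ hco hpos' g

end TowerAny

/-! ## §4 `k = n+1` levels on the diagonal, geometric profile: `C_E` free of the height -/

section TowerDiagonal

variable {d : ℕ} (L : ℕ) [NeZero L] (m : Fin d → ℕ) [∀ i, NeZero (m i)] (n : ℕ)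
  {𝔸 : Type*} [NormedRing 𝔸] [NormedAlgebra ℂ 𝔸] [CompleteSpace 𝔸] [NormOneClass 𝔸]
  {W : Type*} [NormedAddCommGroup W] [InnerProductSpace ℂ W] [FiniteDimensional ℂ W] (φ : W ≃ₗ[ℂ] 𝔸)
  (c₀ : ℝ) [Fact (0 < c₀)] (η : ℝ) (c₁ : ℝ) [Fact (0 < c₁)] {a' : ℝ}
  (U : Bond d (towerP L m (n + 1)) → 𝔸ˣ)
  (hRS : ∀ (b : Bond d (towerP L m (n + 1))) (v u : W), ⟪adTransportW φ U b v, u⟫_ℂ = ⟪v, adTransportW φ (fun b => (U b)⁻¹) b u⟫_ℂ)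
  {Mφ Mφ' : ℝ} (hMφ : 0 ≤ Mφ) (hMφ' : 0 ≤ Mφ') (hφ : ∀ w, ‖φ w‖ ≤ Mφ * ‖w‖) (hφ' : ∀ X, ‖φ.symm X‖ ≤ Mφ' * ‖X‖)
  (ha' : 0 < a') {α : ℝ} (hα : 0 ≤ α) (hUb : ∀ b, U b ∈ U1 𝔸) (hUε : ∀ b, ‖(U b : 𝔸) - 1‖ ≤ α * η)
  (εU : ℕ → ℝ) (hεU : ∀ j, 0 ≤ εU j)
  (hLε : ∀ (j : ℕ) (b : Bond d (towerP L m (j + 1))), ‖(UlevOf L m (n + 1) U j b : 𝔸) - 1‖ ≤ εU j)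
  (hLb : ∀ (j : ℕ) (b : Bond d (towerP L m (j + 1))), UlevOf L m (n + 1) U j b ∈ U1 𝔸)

include hRS hMφ hMφ' hφ hφ' ha' hα hUb hUε hεU hLε hLb in
/-- **(E) AT `k = n+1` LEVELS ON THE DIAGONAL `ηL^{n+1} = 1`, `c₀(L^{n+1})^d = c₁`, GEOMETRIC PROFILE `ε_j ≤ αr^j`**: with
`θ⋆(α) = √d·Kα + (√d·Kα)² + a′ρ⋆(2 + ρ⋆)`, `K = 2M_φM_φ′`, `ρ⋆ = exp(d(L−1)Kα∕(1−r)) − 1`, on the STRICT window `θ⋆(α) < 1∕(2+2∕a′)`: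
`‖G′_k(U)g‖ ≤ (1∕(2+2∕a′) − θ⋆(α))⁻¹·‖g‖` — the `hE` binder of `B9Eq342GreenPrimeTowerSupBound.norm_GpOfUk_apply_le(_unitary)` INHABITED with a
`C_E` that is THE SAME FOR EVERY HEIGHT `n`, every period `m`, every `η` on the diagonal (`norm_greenK_le` ∘ `coercive_laplacePrimeAk_diagonal_geometric`).
[cite: Balaban1985BackgroundPropagators, (3.24)–(3.25) p.394, (3.35)–(3.37) p.396, Thm 3.11 p.416, Thm 3.1 (3.42) p.397] -/
theorem norm_GpOfUk_le_diagonal_geometric (hηL : η * (L : ℝ) ^ (n + 1) = 1) (hw : c₀ * ((L : ℝ) ^ (n + 1)) ^ d = c₁)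
    {r : ℝ} (hr0 : 0 ≤ r) (hr1 : r < 1) (hεg : ∀ j < n + 1, εU j ≤ α * r ^ j)
    (hwin : Real.sqrt d * (2 * Mφ * Mφ') * α + (Real.sqrt d * (2 * Mφ * Mφ') * α) ^ 2 +
          a' * (Real.exp (((d * (L - 1) : ℕ) : ℝ) * (2 * Mφ * Mφ' * α / (1 - r))) - 1) *
            (2 + (Real.exp (((d * (L - 1) : ℕ) : ℝ) * (2 * Mφ * Mφ' * α / (1 - r))) - 1)) < 1 / (2 + 2 / a'))
    (hpos' : ∀ x : SiteL2K ℂ d (towerP L m (n + 1)) c₀ W, x ≠ 0 → 0 < RCLike.re ⟪x, laplacePrimeAk L m n φ η U a' (c₁ := c₁) x⟫_ℂ)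
    (g : SiteL2K ℂ d (towerP L m (n + 1)) c₀ W) :
    ‖GpOfUk L m n φ η U a' hpos' g‖ ≤
      (1 / (2 + 2 / a') -
          (Real.sqrt d * (2 * Mφ * Mφ') * α + (Real.sqrt d * (2 * Mφ * Mφ') * α) ^ 2 +
            a' * (Real.exp (((d * (L - 1) : ℕ) : ℝ) * (2 * Mφ * Mφ' * α / (1 - r))) - 1) *
              (2 + (Real.exp (((d * (L - 1) : ℕ) : ℝ) * (2 * Mφ * Mφ' * α / (1 - r))) - 1))))⁻¹ * ‖g‖ :=
  norm_GpOfUk_le_of_coercive L m n φ η U a' (sub_pos.2 hwin)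
    (coercive_laplacePrimeAk_diagonal_geometric L m n φ c₀ η c₁ U hRS hMφ hMφ' hφ hφ' ha' hα hUb hUε εU hεU hLε hLb hηL hw hr0 hr1 hεg hwin.le)
    hpos' g

end TowerDiagonal

section TowerExists

variable {d : ℕ} (L : ℕ) [NeZero L]
  {𝔸 : Type*} [NormedRing 𝔸] [NormedAlgebra ℂ 𝔸] [CompleteSpace 𝔸] [NormOneClass 𝔸]
  {W : Type*} [NormedAddCommGroup W] [InnerProductSpace ℂ W] [FiniteDimensional ℂ W] (φ : W ≃ₗ[ℂ] 𝔸) {a' : ℝ}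
  {Mφ Mφ' : ℝ} (hMφ : 0 ≤ Mφ) (hMφ' : 0 ≤ Mφ') (hφ : ∀ w, ‖φ w‖ ≤ Mφ * ‖w‖) (hφ' : ∀ X, ‖φ.symm X‖ ≤ Mφ' * ‖X‖)
  (ha' : 0 < a') {r : ℝ} (hr0 : 0 ≤ r) (hr1 : r < 1)

include hMφ hMφ' hφ hφ' ha' hr0 hr1 in
/-- **(E) AT `k` LEVELS, `∃ α₀ C_E > 0` BEFORE EVERY LATTICE ∕ HEIGHT ∕ VOLUME ∕ BACKGROUND BINDER**: with the `α₀`, `γ′ = 1∕(2(2+2∕a′))` of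
`exists_strong_site_coercive_tower_diagonal`, `C_E := (γ′)⁻¹ = 2(2 + 2∕a′)`: for every height `n`, `η` on the diagonal `ηL^{n+1} = 1`, weights
`c₀(L^{n+1})^d = c₁`, period `m`, background `U` of the class (mutually adjoint transporters, `‖U(b) − 1‖ ≤ αη`, `‖Ū^j(b) − 1‖ ≤ ε_j ≤ αr^j`, all in `U1`),
every `α ≤ α₀` and every positivity witness: `‖G′_k(U)g‖ ≤ C_E‖g‖` — print's «B₀ dependent on d and L only» for the energy letter of the substitute route.
[cite: Balaban1985BackgroundPropagators, Thm 3.1 (3.42) p.397, Thm 3.11 p.416, (3.24)–(3.25) p.394, (3.35)–(3.37) p.396] -/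
theorem exists_normBound_GpOfUk_tower_diagonal :
    ∃ α₀ CE : ℝ, 0 < α₀ ∧ 0 < CE ∧ ∀ (n : ℕ) (η : ℝ), η * (L : ℝ) ^ (n + 1) = 1 →
      ∀ (c₀ c₁ : ℝ) [Fact (0 < c₀)] [Fact (0 < c₁)], c₀ * ((L : ℝ) ^ (n + 1)) ^ d = c₁ →
      ∀ (m : Fin d → ℕ) [∀ i, NeZero (m i)] (U : Bond d (towerP L m (n + 1)) → 𝔸ˣ),
        (∀ (b : Bond d (towerP L m (n + 1))) (v u : W), ⟪adTransportW φ U b v, u⟫_ℂ = ⟪v, adTransportW φ (fun b => (U b)⁻¹) b u⟫_ℂ) →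
      ∀ (α : ℝ), 0 ≤ α → α ≤ α₀ → (∀ b, U b ∈ U1 𝔸) → (∀ b, ‖(U b : 𝔸) - 1‖ ≤ α * η) →
      ∀ (εU : ℕ → ℝ), (∀ j, 0 ≤ εU j) → (∀ j < n + 1, εU j ≤ α * r ^ j) →
        (∀ (j : ℕ) (b : Bond d (towerP L m (j + 1))), ‖(UlevOf L m (n + 1) U j b : 𝔸) - 1‖ ≤ εU j) →
        (∀ (j : ℕ) (b : Bond d (towerP L m (j + 1))), UlevOf L m (n + 1) U j b ∈ U1 𝔸) →
      ∀ (hpos' : ∀ x : SiteL2K ℂ d (towerP L m (n + 1)) c₀ W, x ≠ 0 → 0 < RCLike.re ⟪x, laplacePrimeAk L m n φ η U a' (c₁ := c₁) x⟫_ℂ)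
        (g : SiteL2K ℂ d (towerP L m (n + 1)) c₀ W), ‖GpOfUk L m n φ η U a' hpos' g‖ ≤ CE * ‖g‖ := by
  obtain ⟨α₀, γ', hα₀, hγ', H⟩ := exists_strong_site_coercive_tower_diagonal L φ (a' := a') hMφ hMφ' hφ hφ' ha' hr0 hr1
  refine ⟨α₀, γ'⁻¹, hα₀, by positivity, ?_⟩
  intro n η hηL c₀ c₁ _ _ hw m _ U hRS α hα0 hαle hUb hUε εU hεU hεg hLε hLb hpos' g
  refine norm_GpOfUk_le_of_coercive L m n φ η U a' hγ' (fun x => ?_) hpos' g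
  have h := H n η hηL c₀ c₁ hw m U hRS α hα0 hαle hUb hUε εU hεU hεg hLε hLb x
  have hD : 0 ≤ ‖covDerivL2K ℂ c₀ ((η : ℂ))⁻¹ (adTransportW φ (fun _ : Bond d (towerP L m (n + 1)) => (1 : 𝔸ˣ))) x‖ ^ 2 := sq_nonneg _
  have : γ' * ‖x‖ ^ 2 ≤ γ' * (‖covDerivL2K ℂ c₀ ((η : ℂ))⁻¹ (adTransportW φ (fun _ : Bond d (towerP L m (n + 1)) => (1 : 𝔸ˣ))) x‖ ^ 2 + ‖x‖ ^ 2) :=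
    mul_le_mul_of_nonneg_left (by linarith) hγ'.le
  exact this.trans h

end TowerExists

end Literature.MathematicalPhysics.QuantumFieldTheory.Balaban1983to89.B9Eq342GreenPrimeEnergyLetter

end
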